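import Summits.MatrixMultiplication.MatrixMultiplication.Theorems.SoloInformedTwoLines2
import Summits.MatrixMultiplication.MatrixMultiplication.Theorems.SoloInformedTwoCols

/-!
# Near-rectangle pins: the one-cell class readings and the exception table of THEOREM 8.19

This work, §8.8 (T12)(d),(f) and C3-m2 §5.5 (gen 107). Setting: a CU13-Def-12 realization of `⟨n,n,n⟩` in
`𝒮(S⁰ × S¹, ±)` [CohnUmans2013, arXiv:1207.6528, Def. 12] — equation data `D : Data ι G` (no 2-torsion `hG`).

THEOREM 8.19 closes a TRIPLE NEAR-RECTANGLE `a ≈ [v′]` on `I₀ × 𝓛`, `b ≈ [v]` on `𝓛 × K₀` (generic classes: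
`v, v′ ≠ 0`, `v ≁ v′`). This file supplies its algebraic atoms:
* ONE-CELL READINGS — `signEq_or_of_conforming` (`a ∼ v′, b ∼ v ⟹ c ∈ {[v′+v],[v′−v]}`),
  `a_classes_of_dev` (`b ∼ v, c ∼ v′+v ⟹ a ∼ v′ ∨ a ∼ v′+2v`), `b_classes_of_dev` (`a ∼ v′, c ∼ v′+v ⟹
  b ∼ v ∨ b ∼ v+2v′`): every deviation in a 2-classed near-rectangle lies in ONE determined second class;
* THE PIN `π_b` — `Data.c_signEq_c_of_b_dev`: a `b`-deviation `b(j_d,k) ≁ v` in column `k` pins the `c`-row `k`: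
  any two rows `i, i′` conforming at `j_d` and at some conforming `j` have `c(k,i) ∼ c(k,i′)`;
* THE EXCEPTION TABLE of (T12)(d) for the classes `(v′, v′+2v ∣ v, v+2v′ ∣ v′+v, v′−v)`: the four admissible
  and three non-admissible triples (`table_t0 … table_nbc`), valid iff `v ≠ 0`, `v′ ≠ 0`, `v + v′ ≠ 0` — exactly the
  hypotheses of THEOREM 8.18 (`Data.card_unstarred_le`).
-/

namespace Summit.MatrixMultiplication.MatrixMultiplication.Theorems.TwistedTPP

namespace FibreLines

variable {ι G : Type*} [AddCommGroup G]

/-- Conforming cell: `a ∼ v′`, `b ∼ v` ⟹ `c ∼ v′ + v ∨ c ∼ v′ − v`. -/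
theorem signEq_or_of_conforming {a b c v v' : G} (h : Adm a b c) (ha : SignEq a v') (hb : SignEq b v) :
    SignEq c (v' + v) ∨ SignEq c (v' - v) :=
  ((h.of_signEq_left ha).of_signEq_mid hb).signEq_add_or_sub

/-- `a`-deviation reading: `b ∼ v`, `c ∼ v′ + v` ⟹ `a ∼ v′ ∨ a ∼ v′ + v + v`. -/
theorem a_classes_of_dev {a b c v v' : G} (h : Adm a b c) (hb : SignEq b v) (hc : SignEq c (v' + v)) :
    SignEq a v' ∨ SignEq a (v' + v + v) := by
  have h' : Adm v (v' + v) a := ((h.of_signEq_mid hb).of_signEq_right hc).rotate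
  rcases h'.signEq_add_or_sub with h1 | h1
  · right; have e : v + (v' + v) = v' + v + v := by abel
    rw [e] at h1; exact h1
  · left; have e : v - (v' + v) = -v' := by abel
    rw [e, signEq_neg_right] at h1; exact h1

/-- `b`-deviation reading: `a ∼ v′`, `c ∼ v′ + v` ⟹ `b ∼ v ∨ b ∼ v + v′ + v′`. -/
theorem b_classes_of_dev {a b c v v' : G} (h : Adm a b c) (ha : SignEq a v') (hc : SignEq c (v' + v)) :
    SignEq b v ∨ SignEq b (v + v' + v') := by
  have h' : Adm v' (v' + v) b := ((h.of_signEq_left ha).of_signEq_right hc).swap.rotate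
  rcases h'.signEq_add_or_sub with h1 | h1
  · right; have e : v' + (v' + v) = v + v' + v' := by abel
    rw [e] at h1; exact h1
  · left; have e : v' - (v' + v) = -v := by abel
    rw [e, signEq_neg_right] at h1; exact h1

/-- `c`-deviation reading: a conforming cell with `c ≁ v′ + v` has `c ∼ v′ − v`. -/
theorem c_class_of_dev {a b c v v' : G} (h : Adm a b c) (ha : SignEq a v') (hb : SignEq b v)
    (hc : ¬ SignEq c (v' + v)) : SignEq c (v' - v) :=
  (signEq_or_of_conforming h ha hb).resolve_left hc

/-- **The pin `π_b`.** A `b`-deviation `b(j_d,k) ≁ v` pins row `k` of `c`: if rows `i, i′` conform at `j_d`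
(`a ∼ v′`) and each has a conforming cell in column `k` (`a(i,j₁) ∼ v′, b(j₁,k) ∼ v`, resp. `j₂`), then
`c(k,i) ∼ c(k,i′)`. [this work, §8.8 (T12)(f) step (2)] -/
theorem Data.c_signEq_c_of_b_dev (hG : ∀ x : G, x = -x → x = 0) (D : Data ι G) {v v' : G}
    {i i' jd j₁ j₂ k : ι} (hdev : ¬ SignEq v (D.b jd k)) (hai : SignEq (D.a i jd) v')
    (hai' : SignEq (D.a i' jd) v') (ha₁ : SignEq (D.a i j₁) v') (hb₁ : SignEq (D.b j₁ k) v)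
    (ha₂ : SignEq (D.a i' j₂) v') (hb₂ : SignEq (D.b j₂ k) v) : SignEq (D.c k i) (D.c k i') := by
  by_contra hne
  exact hdev (signEq_of_adm_adm hG (((D.adm_eqn i j₁ k).of_signEq_left ha₁).of_signEq_mid hb₁)
    (((D.adm_eqn i' j₂ k).of_signEq_left ha₂).of_signEq_mid hb₂) ((D.adm_eqn i jd k).of_signEq_left hai)
    ((D.adm_eqn i' jd k).of_signEq_left hai') hne)

/-! ### The exception table for `(p, p′, q, q′, u, u′) = (v′, v′+v+v, v, v+v′+v′, v′+v, v′−v)` -/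

/-- No 2-torsion: `y ≠ 0 ⟹ y + y ≠ 0`. -/
theorem add_self_ne_zero (hG : ∀ x : G, x = -x → x = 0) {y : G} (hy : y ≠ 0) : y + y ≠ 0 :=
  fun h => hy (hG _ (eq_neg_of_add_eq_zero_left h))

/-- `t0`: `Adm v′ v (v′+v)`. -/
theorem table_t0 (v v' : G) : Adm v' v (v' + v) := Or.inr (Or.inl (sub_self _))

/-- `ta`: `Adm (v′+v+v) v (v′+v)`. -/
theorem table_ta (v v' : G) : Adm (v' + v + v) v (v' + v) :=
  Or.inr (Or.inr (Or.inr (by abel)))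

/-- `tb`: `Adm v′ (v+v′+v′) (v′+v)`. -/
theorem table_tb (v v' : G) : Adm v' (v + v' + v') (v' + v) :=
  Or.inr (Or.inr (Or.inl (by abel)))

/-- `tc`: `Adm v′ v (v′−v)`. -/
theorem table_tc (v v' : G) : Adm v' v (v' - v) := Or.inr (Or.inr (Or.inr (by abel)))

/-- `nab`: `¬ Adm (v′+v+v) (v+v′+v′) (v′+v)` when `v, v′, v+v′ ≠ 0`. -/
theorem table_nab (hG : ∀ x : G, x = -x → x = 0) {v v' : G} (hv : v ≠ 0) (hv' : v' ≠ 0)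
    (hs : v + v' ≠ 0) : ¬ Adm (v' + v + v) (v + v' + v') (v' + v) := by
  have h2s := add_self_ne_zero hG hs
  rintro (h | h | h | h)
  · apply add_self_ne_zero hG h2s
    have e : v + v' + (v + v') + (v + v' + (v + v')) = v' + v + v + (v + v' + v') + (v' + v) := by abel
    rw [e, h]
  · apply h2s
    have e : v + v' + (v + v') = v' + v + v + (v + v' + v') - (v' + v) := by abel
    rw [e, h]
  · apply add_self_ne_zero hG hv
    have e : v + v = v' + v + v - (v + v' + v') + (v' + v) := by abel
    rw [e, h]
  · apply add_self_ne_zero hG hv'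
    have e : v' + v' = -(v' + v + v - (v + v' + v') - (v' + v)) := by abel
    rw [e, h, neg_zero]

/-- `nac`: `¬ Adm (v′+v+v) v (v′−v)` when `v, v′, v+v′ ≠ 0`. -/
theorem table_nac (hG : ∀ x : G, x = -x → x = 0) {v v' : G} (hv : v ≠ 0) (hv' : v' ≠ 0)
    (hs : v + v' ≠ 0) : ¬ Adm (v' + v + v) v (v' - v) := by
  rintro (h | h | h | h)
  · apply add_self_ne_zero hG hs
    have e : v + v' + (v + v') = v' + v + v + v + (v' - v) := by abel
    rw [e, h]
  · apply add_self_ne_zero hG (add_self_ne_zero hG hv)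
    have e : v + v + (v + v) = v' + v + v + v - (v' - v) := by abel
    rw [e, h]
  · apply add_self_ne_zero hG hv'
    have e : v' + v' = v' + v + v - v + (v' - v) := by abel
    rw [e, h]
  · apply add_self_ne_zero hG hv
    have e : v + v = v' + v + v - v - (v' - v) := by abel
    rw [e, h]

/-- `nbc`: `¬ Adm v′ (v+v′+v′) (v′−v)` when `v, v′, v+v′ ≠ 0`. -/
theorem table_nbc (hG : ∀ x : G, x = -x → x = 0) {v v' : G} (hv : v ≠ 0) (hv' : v' ≠ 0)
    (hs : v + v' ≠ 0) : ¬ Adm v' (v + v' + v') (v' - v) := by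
  rintro (h | h | h | h)
  · apply add_self_ne_zero hG (add_self_ne_zero hG hv')
    have e : v' + v' + (v' + v') = v' + (v + v' + v') + (v' - v) := by abel
    rw [e, h]
  · apply add_self_ne_zero hG hs
    have e : v + v' + (v + v') = v' + (v + v' + v') - (v' - v) := by abel
    rw [e, h]
  · apply add_self_ne_zero hG hv
    have e : v + v = -(v' - (v + v' + v') + (v' - v)) := by abel
    rw [e, h, neg_zero]
  · apply add_self_ne_zero hG hv'
    have e : v' + v' = -(v' - (v + v' + v') - (v' - v)) := by abel
    rw [e, h, neg_zero]

end FibreLines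

end Summit.MatrixMultiplication.MatrixMultiplication.Theorems.TwistedTPP
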